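import Literature.AlgebraicGeometry.Deformation.FlatDeformationTransitionData
import Literature.AlgebraicGeometry.Deformation.SmoothSchemeLiftTransitionDataLift
import Literature.AlgebraicGeometry.Deformation.SmoothSchemeLiftObstructionRefine
import Literature.AlgebraicGeometry.Morphisms.NilpotentThickeningCoverLift
import HarnessLib

/-!
# The chart trivialisations of a flat deformation restrict to a basic-open refinement, and the restricted transition
# lifts reduce to the restricted transition data (Hartshorne, *Deformation Theory*, proof of Thm. 10.2 (a): «restricting to
# `U_{ijk}`», for a refinement)

Layer `Literature/AlgebraicGeometry/Deformation`, namespace `Literature.AlgebraicGeometry.Deformation` (THEOREMS only: no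
definition, no instance, no notation, no named fact).  Currency of ★ c2b `FlatDeformationTransitionData{,Cover}` and ★ GAP-1
`SmoothSchemeLiftTransitionDataLift` (`π' : Ā → k`, `Ā = A ⧸ J`, `J² = 0`; closed fibre `X/k` smooth with `halg`, flat
deformation `Y/Ā` with `halgA`, closed-fibre inclusion `i` (`hi`), a closed immersion with nilpotent ideal; a principal affine
cover `U'` of `Y` with `U j = i⁻¹U' j`, chart trivialisations `e j` over the closed fibres with overlap restrictions `ε₁ ε₂`,
transition data `φ j l = transition (ε₁ j l) (ε₂ j l) ≡ 1 (mod ker π')`, and `A`-lifts `ψ` of them (GAP-1 (L))), of ★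
`SmoothSchemeLiftObstructionRefine` (a refinement `V` of `U` BY BASIC OPENS, `V s = D(a s) ⊆ U (τ s)`, and the RESTRICTED lifts
`ψV s t` of the `ψ (τ s) (τ t)` to `A ⊗_k Γ(X, V s ∩ V t)`) and of ★ `Morphisms/NilpotentThickeningCoverLift` (opens of `Y` are
determined by their preimages in `X`).

THE FEED OF `FlatDeformationTwoChartSystems` (**`exists_charts_refine`**): given moreover opens `O s ⊆ Y` above the `V s`
(`i⁻¹O s = V s`, ★ `exists_preimage_eq`), the charts RESTRICT to the refinement — `εV s : Ā ⊗_k Γ(X, V s) ≃ₐ[Ā] Γ(Y, O s)` over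
the closed fibres with overlap restrictions `εV₁ εV₂` on `O s ∩ O t` — and the restricted lifts REDUCE to their transition data:
`σ̂ ∘ ψV s t = transition (εV₁ s t) (εV₂ s t) ∘ σ̂`.  Road: `O s = D(g s)` for a lift `g s ∈ Γ(Y, U' (τ s))` of `a s`
(★ `app_surjective`, ★ `preimage_injective_of_isNilpotent_ker`), so ★ c2b `exists_restrict_algEquiv` restricts `e (τ s)`; the
overlaps `O s ∩ O t = D(g̃)` likewise; `ψV s t` reduces to the restriction of `φ (τ s) (τ t)` (★ GAP-1
`reductionHom_algEquiv_restrict` along the principal open `V s ∩ V t = D(a s|·a t|)` of `U (τ s) ∩ U (τ t)`), which IS the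
transition of the restricted charts (★ c1 `eq_transition_of_restrict`, the two-step restrictions agreeing by ★ c2b
`restrict_restrict`).

Cell `hodgecm-mathlib`, F-11 road (a′), slot (4) rel₂ (applied once to the cover `U` and once to `[2]⁻¹U`).  HC_CM is proved
only modulo the 7 printed citations until rung 0 closes — nothing here bears on a summit statement.

## References
* [Hartshorne2010] R. Hartshorne, *Deformation Theory*, GTM 257, Springer (2010): Thm. 10.2 (a) and its proof (p. 81),
  Cor. 4.8 (pp. 32–33).
* [AtiyahMacdonald1969] M. F. Atiyah, I. G. Macdonald, *Introduction to Commutative Algebra* (1969): Prop. 3.5.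
* [StacksProject] The Stacks Project, Tag 04EX (thickenings).
-/

noncomputable section

-- `TopCat.Presheaf`/`TopCat.Sheaf` are not reducible (as in Mathlib's `AlgebraicGeometry/Modules`).
set_option backward.isDefEq.respectTransparency false

open CategoryTheory AlgebraicGeometry Opposite TopologicalSpace Limits
open scoped TensorProduct

universe u

namespace Literature.AlgebraicGeometry.Deformation

open Literature.AlgebraicGeometry.Motives Literature.AlgebraicGeometry.Morphisms SmoothAffineDeformation

variable {k : Type u} [Field k] {A : Type u} [CommRing A] [Algebra k A] {J : Ideal A} (π' : (A ⧸ J) →ₐ[k] k)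
  {X : Over (Spec (CommRingCat.of k))} [instΓ : ∀ W : X.left.Opens, Algebra k Γ(X.left, W)]
  (halg : ∀ (W : X.left.Opens) (s : k), algebraMap k Γ(X.left, W) s = (constToPresheaf X).app (op W) s)
  {Y : Over (Spec (CommRingCat.of (A ⧸ J)))} [instΓA : ∀ W : Y.left.Opens, Algebra (A ⧸ J) Γ(Y.left, W)]
  (halgA : ∀ (W : Y.left.Opens) (a : A ⧸ J), algebraMap (A ⧸ J) Γ(Y.left, W) a = (constToPresheaf Y).app (op W) a)
  (i : X.left ⟶ Y.left) (hi : IsPullback i X.hom Y.hom (Spec.map (CommRingCat.ofHom π'.toRingHom)))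

include halg in
/-- Restriction `Γ(X, V) → Γ(X, W)` commutes with the `k`-structures fixed by `halg` (for the canonical instance this is
★ `Motives.FieldNorm.map_algebraMap_sec`, whence `private`). [cite: Hartshorne1977, II.8 p. 172] -/
private theorem map_algebraMap_halg' {V W : X.left.Opens} (h : W ≤ V) (s : k) :
    X.left.presheaf.map (homOfLE h).op (algebraMap k Γ(X.left, V) s) = algebraMap k Γ(X.left, W) s := by
  rw [halg, halg, map_constToPresheaf_app_of_le]

omit instΓ instΓA in
/-- Restricting twice is restricting once (sections of `X`). [folklore] -/
private theorem map_map_X {W₁ W₂ W₃ : X.left.Opens} (h₁₂ : W₂ ≤ W₁) (h₂₃ : W₃ ≤ W₂) (s : Γ(X.left, W₁)) :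
    X.left.presheaf.map (homOfLE h₂₃).op (X.left.presheaf.map (homOfLE h₁₂).op s) =
      X.left.presheaf.map (homOfLE (h₂₃.trans h₁₂)).op s := by
  rw [← CommRingCat.comp_apply, ← X.left.presheaf.map_comp]
  rfl

omit instΓ instΓA in
/-- Restricting twice is restricting once (sections of `Y`). [folklore] -/
private theorem map_map_Y {W₁ W₂ W₃ : Y.left.Opens} (h₁₂ : W₂ ≤ W₁) (h₂₃ : W₃ ≤ W₂) (s : Γ(Y.left, W₁)) :
    Y.left.presheaf.map (homOfLE h₂₃).op (Y.left.presheaf.map (homOfLE h₁₂).op s) =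
      Y.left.presheaf.map (homOfLE (h₂₃.trans h₁₂)).op s := by
  rw [← CommRingCat.comp_apply, ← Y.left.presheaf.map_comp]
  rfl

include hi halg halgA in
/-- **THE CHARTS RESTRICT TO A BASIC-OPEN REFINEMENT, AND THE RESTRICTED LIFTS REDUCE TO THE RESTRICTED TRANSITION DATA.**
Data: a principal affine cover `U'` of `Y` (`hb'`) with `U j = i⁻¹U' j` principal downstairs (`hb`), chart trivialisations
`e j` over the closed fibres with overlap restrictions `ε₁ ε₂` and transition data `≡ 1 (mod ker π')` (`hφ`), `A`-lifts `ψ`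
(GAP-1 (L): `hL`); a principal affine refinement `V` (`hc`) of `U` by basic opens (`V s = D(a s) ⊆ U (τ s)`), opens `O s ⊆ Y`
with `i⁻¹O s = V s`, and restricted lifts `ψV` (★ `exists_algEquiv_refine`).  Conclusion: restricted charts `εV s` on `O s`
over the closed fibres, their overlap restrictions `εV₁ εV₂`, and `σ̂ ∘ ψV s t = transition (εV₁ s t) (εV₂ s t) ∘ σ̂` — the
one-sided input of ★ `exists_chartAut_of_two_chart_systems`. [cite: Hartshorne2010, Thm. 10.2 (proof), p. 81]
[cite: Hartshorne2010, Cor. 4.8, pp. 32–33] [cite: StacksProject, Tag 04EX] -/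
theorem exists_charts_refine [IsClosedImmersion i] (hnil : IsNilpotent i.ker) (h𝔫 : IsNilpotent (RingHom.ker π'))
    {ι : Type u} (U' : ι → Y.left.affineOpens) (b' : (j l : ι) → Γ(Y.left, (U' j).1))
    (hb' : ∀ j l, (U' j).1 ⊓ (U' l).1 = Y.left.basicOpen (b' j l))
    (U : ι → X.left.affineOpens) (hU : ∀ j, (U j).1 = i ⁻¹ᵁ (U' j).1)
    (b : (j l : ι) → Γ(X.left, (U j).1)) (hb : ∀ j l, (U j).1 ⊓ (U l).1 = X.left.basicOpen (b j l))
    (e : ∀ j, (A ⧸ J) ⊗[k] Γ(X.left, (U j).1) ≃ₐ[A ⧸ J] Γ(Y.left, (U' j).1))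
    (he : ∀ j x, i.appLE (U' j).1 (U j).1 (hU j).le (e j x) = specialFibreHom π' _ x)
    (ε₁ ε₂ : ∀ j l, (A ⧸ J) ⊗[k] Γ(X.left, (U j).1 ⊓ (U l).1) ≃ₐ[A ⧸ J] Γ(Y.left, (U' j).1 ⊓ (U' l).1))
    (hε₁ : ∀ j l (a : A ⧸ J) (s : Γ(X.left, (U j).1)),
      ε₁ j l (a ⊗ₜ X.left.presheaf.map (homOfLE inf_le_left).op s) =
        Y.left.presheaf.map (homOfLE inf_le_left).op (e j (a ⊗ₜ s)))
    (hε₂ : ∀ j l (a : A ⧸ J) (s : Γ(X.left, (U l).1)),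
      ε₂ j l (a ⊗ₜ X.left.presheaf.map (homOfLE inf_le_right).op s) =
        Y.left.presheaf.map (homOfLE inf_le_right).op (e l (a ⊗ₜ s)))
    (hφ : ∀ j l x, transition (ε₁ j l) (ε₂ j l) x - x ∈
      (RingHom.ker π') • (⊤ : Submodule (A ⧸ J) ((A ⧸ J) ⊗[k] Γ(X.left, (U j).1 ⊓ (U l).1))))
    (ψ : ∀ j l, A ⊗[k] Γ(X.left, (U j).1 ⊓ (U l).1) ≃ₐ[A] A ⊗[k] Γ(X.left, (U j).1 ⊓ (U l).1))
    (hL : ∀ j l x, Algebra.TensorProduct.map (Ideal.Quotient.mkₐ k J) (AlgHom.id k Γ(X.left, (U j).1 ⊓ (U l).1)) (ψ j l x) =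
      transition (ε₁ j l) (ε₂ j l)
        (Algebra.TensorProduct.map (Ideal.Quotient.mkₐ k J) (AlgHom.id k Γ(X.left, (U j).1 ⊓ (U l).1)) x))
    -- the refinement by basic opens, the opens above it, the restricted lifts
    {κ : Type u} (V : κ → X.left.Opens) (c : (s t : κ) → Γ(X.left, V s))
    (hc : ∀ s t, V s ⊓ V t = X.left.basicOpen (c s t))
    (τ : κ → ι) (hτ : ∀ s, V s ≤ (U (τ s)).1)
    (a : (s : κ) → Γ(X.left, (U (τ s)).1)) (hVa : ∀ s, V s = X.left.basicOpen (a s))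
    (O : κ → Y.left.Opens) (hO : ∀ s, i ⁻¹ᵁ O s = V s)
    (ψV : ∀ s t, A ⊗[k] Γ(X.left, V s ⊓ V t) ≃ₐ[A] A ⊗[k] Γ(X.left, V s ⊓ V t))
    (hψV : ∀ (s t : κ) (Φ : A ⊗[k] Γ(X.left, (U (τ s)).1 ⊓ (U (τ t)).1) →ₐ[A] A ⊗[k] Γ(X.left, V s ⊓ V t)),
      (∀ a' x, Φ (a' ⊗ₜ x) = a' ⊗ₜ X.left.presheaf.map (homOfLE (inf_le_inf (hτ s) (hτ t))).op x) →
      ∀ x, ψV s t (Φ x) = Φ (ψ (τ s) (τ t) x)) :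
    ∃ (εV : ∀ s, (A ⧸ J) ⊗[k] Γ(X.left, V s) ≃ₐ[A ⧸ J] Γ(Y.left, O s))
      (εV₁ εV₂ : ∀ s t, (A ⧸ J) ⊗[k] Γ(X.left, V s ⊓ V t) ≃ₐ[A ⧸ J] Γ(Y.left, O s ⊓ O t)),
      (∀ s x, i.appLE (O s) (V s) (hO s).ge (εV s x) = specialFibreHom π' _ x) ∧
      (∀ s t (a' : A ⧸ J) (x : Γ(X.left, V s)),
        εV₁ s t (a' ⊗ₜ X.left.presheaf.map (homOfLE inf_le_left).op x) =
          Y.left.presheaf.map (homOfLE inf_le_left).op (εV s (a' ⊗ₜ x))) ∧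
      (∀ s t (a' : A ⧸ J) (x : Γ(X.left, V t)),
        εV₂ s t (a' ⊗ₜ X.left.presheaf.map (homOfLE inf_le_right).op x) =
          Y.left.presheaf.map (homOfLE inf_le_right).op (εV t (a' ⊗ₜ x))) ∧
      ∀ s t x, Algebra.TensorProduct.map (Ideal.Quotient.mkₐ k J) (AlgHom.id k Γ(X.left, V s ⊓ V t)) (ψV s t x) =
        transition (εV₁ s t) (εV₂ s t)
          (Algebra.TensorProduct.map (Ideal.Quotient.mkₐ k J) (AlgHom.id k Γ(X.left, V s ⊓ V t)) x) := by
  classical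
  -- normalise the covers downstairs: `U j = i⁻¹ U' j`, `V s = i⁻¹ O s` on the nose (c2b's device)
  obtain rfl : U = fun j => ⟨i ⁻¹ᵁ (U' j).1, isAffineOpen_preimage_closedFibre π' i hi (U' j).2⟩ :=
    funext fun j => Subtype.ext (hU j)
  obtain rfl : V = fun s => i ⁻¹ᵁ O s := funext fun s => (hO s).symm
  have he' : ∀ j x, i.app (U' j).1 (e j x) = specialFibreHom π' _ x := fun j x => by
    have h := he j x
    rwa [Scheme.Hom.appLE_eq_app] at h
  let σ : A →ₐ[k] A ⧸ J := Ideal.Quotient.mkₐ k J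
  -- (a) `O s = D(g s)` for a lift `g s ∈ Γ(Y, U' (τ s))` of `a s`
  have hga := fun s => app_surjective π' i hi (U' (τ s)).2 (a s)
  choose g hg using hga
  have hOg : ∀ s, O s = Y.left.basicOpen (g s) := fun s =>
    preimage_injective_of_isNilpotent_ker i hnil (by rw [Scheme.preimage_basicOpen, hg, ← hVa])
  have hOU : ∀ s, O s ≤ (U' (τ s)).1 := fun s => (hOg s).le.trans (Y.left.basicOpen_le _)
  have hOaff : ∀ s, IsAffineOpen (O s) := fun s => by
    rw [hOg s]
    exact (U' (τ s)).2.basicOpen _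
  -- (b) the restricted charts `εV s` (★ c2b `exists_restrict_algEquiv`)
  have hεV := fun s => exists_restrict_algEquiv π' halg halgA i hi h𝔫 (U' (τ s)).2 (g s) (hOg s) (hOU s)
    (V₁ := i ⁻¹ᵁ O s) rfl (hτ s) (e (τ s)) (he' (τ s))
  choose εV hεVres hεVfib using hεV
  have hεVfib' : ∀ s x, i.app (O s) (εV s x) = specialFibreHom π' _ x := fun s x => by
    have h := hεVfib s x
    rwa [Scheme.Hom.appLE_eq_app] at h
  -- (c) the overlaps `O s ∩ O t` are principal in `O s` and in `O t` (lift the `c s t`)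
  have hgc := fun s t => app_surjective π' i hi (hOaff s) (c s t)
  choose g₁ hg₁ using hgc
  have hO₁ : ∀ s t, O s ⊓ O t = Y.left.basicOpen (g₁ s t) := fun s t =>
    preimage_injective_of_isNilpotent_ker i hnil (by rw [Scheme.preimage_basicOpen, hg₁, ← hc]; rfl)
  have hgc' := fun s t => app_surjective π' i hi (hOaff t) (c t s)
  choose g₂ hg₂ using hgc'
  have hO₂ : ∀ s t, O s ⊓ O t = Y.left.basicOpen (g₂ s t) := fun s t =>
    preimage_injective_of_isNilpotent_ker i hnil (by rw [Scheme.preimage_basicOpen, hg₂, ← hc, inf_comm]; rfl)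
  -- (d) the overlap restrictions of the restricted charts
  have hεV₁ := fun s t => exists_restrict_algEquiv π' halg halgA i hi h𝔫 (hOaff s) (g₁ s t) (hO₁ s t) inf_le_left
    (V₁ := i ⁻¹ᵁ O s ⊓ i ⁻¹ᵁ O t) rfl inf_le_left (εV s) (hεVfib' s)
  choose εV₁ hεV₁res _hεV₁fib using hεV₁
  have hεV₂ := fun s t => exists_restrict_algEquiv π' halg halgA i hi h𝔫 (hOaff t) (g₂ s t) (hO₂ s t) inf_le_right
    (V₁ := i ⁻¹ᵁ O s ⊓ i ⁻¹ᵁ O t) rfl inf_le_right (εV t) (hεVfib' t)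
  choose εV₂ hεV₂res _hεV₂fib using hεV₂
  refine ⟨εV, εV₁, εV₂, hεVfib, hεV₁res, hεV₂res, fun s t x => ?_⟩
  -- (e) the restricted lift reduces to the restricted transition datum
  -- the pairwise overlap of the refinement is principal in that of the cover
  have h2 : i ⁻¹ᵁ O s ⊓ i ⁻¹ᵁ O t ≤ i ⁻¹ᵁ (U' (τ s)).1 ⊓ i ⁻¹ᵁ (U' (τ t)).1 := inf_le_inf (hτ s) (hτ t)
  obtain ⟨f₂, hV2⟩ : ∃ f : Γ(X.left, i ⁻¹ᵁ (U' (τ s)).1 ⊓ i ⁻¹ᵁ (U' (τ t)).1),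
      i ⁻¹ᵁ O s ⊓ i ⁻¹ᵁ O t = X.left.basicOpen f :=
    ⟨_, refine_inf₂_eq_basicOpen (fun j => (⟨i ⁻¹ᵁ (U' j).1, isAffineOpen_preimage_closedFibre π' i hi (U' j).2⟩ :
      X.left.affineOpens)) (fun s => i ⁻¹ᵁ O s) τ hτ a hVa s t⟩
  have hU2aff : IsAffineOpen (i ⁻¹ᵁ (U' (τ s)).1 ⊓ i ⁻¹ᵁ (U' (τ t)).1) :=
    isAffineOpen_inf₂ (fun j => (⟨i ⁻¹ᵁ (U' j).1, isAffineOpen_preimage_closedFibre π' i hi (U' j).2⟩ :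
      X.left.affineOpens)) b hb (τ s) (τ t)
  obtain ⟨Φ, hΦ⟩ := exists_baseChangeMap (A' := A) halg (i ⁻¹ᵁ (U' (τ s)).1 ⊓ i ⁻¹ᵁ (U' (τ t)).1)
    (i ⁻¹ᵁ O s ⊓ i ⁻¹ᵁ O t) h2
  obtain ⟨Ψ, hΨ⟩ := exists_baseChangeMap (A' := A ⧸ J) halg (i ⁻¹ᵁ (U' (τ s)).1 ⊓ i ⁻¹ᵁ (U' (τ t)).1)
    (i ⁻¹ᵁ O s ⊓ i ⁻¹ᵁ O t) h2
  -- the restriction `ρ̄` of the transition datum over `A ⧸ J`, and naturality of `σ̂` (★ GAP-1)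
  obtain ⟨ρ, hρ, -⟩ := exists_algEquiv_restrict halg (RingHom.ker π') hU2aff f₂ hV2 h2 h𝔫
    (transition (ε₁ (τ s) (τ t)) (ε₂ (τ s) (τ t))) (hφ _ _) hΨ
  have hnat : ∀ y, reductionHom σ _ (ψV s t y) = ρ (reductionHom σ _ y) :=
    reductionHom_algEquiv_restrict σ hU2aff f₂ hV2 h2 (ψ (τ s) (τ t)) (transition (ε₁ (τ s) (τ t)) (ε₂ (τ s) (τ t)))
      (hL (τ s) (τ t)) hΦ hΨ (hψV s t Φ hΦ) hρ
  -- `ρ̄` IS the transition of the restricted charts (★ c1 `eq_transition_of_restrict`; the two-step restrictions of the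
  -- charts agree with the one-step ones, ★ c2b `restrict_restrict`)
  have hU'2s : (U' (τ s)).1 ⊓ (U' (τ t)).1 = Y.left.basicOpen (b' (τ s) (τ t)) := hb' _ _
  have hU'2t : (U' (τ s)).1 ⊓ (U' (τ t)).1 = Y.left.basicOpen (b' (τ t) (τ s)) := by
    rw [inf_comm]
    exact hb' _ _
  have hO2 : O s ⊓ O t ≤ (U' (τ s)).1 ⊓ (U' (τ t)).1 := inf_le_inf (hOU s) (hOU t)
  have hδ₁ : ∀ (a' : A ⧸ J) (x : Γ(X.left, i ⁻¹ᵁ (U' (τ s)).1)),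
      εV₁ s t (a' ⊗ₜ X.left.presheaf.map (homOfLE (h2.trans inf_le_left)).op x) =
        Y.left.presheaf.map (homOfLE (hO2.trans inf_le_left)).op (e (τ s) (a' ⊗ₜ x)) := fun a' x => by
    rw [← map_map_X (hτ s) inf_le_left x, hεV₁res, hεVres, map_map_Y]
  have hδ₂ : ∀ (a' : A ⧸ J) (x : Γ(X.left, i ⁻¹ᵁ (U' (τ t)).1)),
      εV₂ s t (a' ⊗ₜ X.left.presheaf.map (homOfLE (h2.trans inf_le_right)).op x) =
        Y.left.presheaf.map (homOfLE (hO2.trans inf_le_right)).op (e (τ t) (a' ⊗ₜ x)) := fun a' x => by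
    rw [← map_map_X (hτ t) inf_le_right x, hεV₂res, hεVres, map_map_Y]
  have h₁ := restrict_restrict π' halg halgA i hi (U' (τ s)).2 (b' (τ s) (τ t)) hU'2s inf_le_left hO2
    (V₁ := i ⁻¹ᵁ (U' (τ s)).1 ⊓ i ⁻¹ᵁ (U' (τ t)).1) rfl inf_le_left h2 (e (τ s)) (ε₁ (τ s) (τ t)) (hε₁ (τ s) (τ t))
    (εV₁ s t) hδ₁
  have h₂ := restrict_restrict π' halg halgA i hi (U' (τ t)).2 (b' (τ t) (τ s)) hU'2t inf_le_right hO2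
    (V₁ := i ⁻¹ᵁ (U' (τ s)).1 ⊓ i ⁻¹ᵁ (U' (τ t)).1) rfl inf_le_right h2 (e (τ t)) (ε₂ (τ s) (τ t)) (hε₂ (τ s) (τ t))
    (εV₂ s t) hδ₂
  have hρ' : ρ = transition (εV₁ s t) (εV₂ s t) := by
    letI algX : Algebra Γ(X.left, i ⁻¹ᵁ (U' (τ s)).1 ⊓ i ⁻¹ᵁ (U' (τ t)).1) Γ(X.left, i ⁻¹ᵁ O s ⊓ i ⁻¹ᵁ O t) :=
      (X.left.presheaf.map (homOfLE h2).op).hom.toAlgebra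
    haveI : IsScalarTower k Γ(X.left, i ⁻¹ᵁ (U' (τ s)).1 ⊓ i ⁻¹ᵁ (U' (τ t)).1) Γ(X.left, i ⁻¹ᵁ O s ⊓ i ⁻¹ᵁ O t) :=
      IsScalarTower.of_algebraMap_eq fun c' => (map_algebraMap_halg' halg h2 c').symm
    haveI : IsLocalization.Away f₂ Γ(X.left, i ⁻¹ᵁ O s ⊓ i ⁻¹ᵁ O t) :=
      hU2aff.isLocalization_of_eq_basicOpen f₂ (homOfLE h2) hV2
    letI algY : Algebra Γ(Y.left, (U' (τ s)).1 ⊓ (U' (τ t)).1) Γ(Y.left, O s ⊓ O t) :=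
      (Y.left.presheaf.map (homOfLE hO2).op).hom.toAlgebra
    haveI : IsScalarTower (A ⧸ J) Γ(Y.left, (U' (τ s)).1 ⊓ (U' (τ t)).1) Γ(Y.left, O s ⊓ O t) :=
      IsScalarTower.of_algebraMap_eq fun a' => (map_algebraMap_A halgA hO2 a').symm
    exact eq_transition_of_restrict (k := k) f₂ (ε₁ (τ s) (τ t)) (ε₂ (τ s) (τ t)) (εV₁ s t) (εV₂ s t) h₁ h₂ hΨ ρ hρ
  have key := hnat x
  rw [hρ'] at key
  exact key

end Literature.AlgebraicGeometry.Deformation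

end
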